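import Literature.NumberTheory.LFunctions.SchoenfeldSieve
import Mathlib.Analysis.SpecialFunctions.Log.Monotone
import HarnessLib

/-!
# Schoenfeld 1976, (6.20) on `[3169, 5·10⁷]`: a certified computation of `0 < {li(x) − π(x)} log x/√x < 2.523`

Topic: `Literature/NumberTheory/LFunctions`. The executable checker (with a complete soundness proof)
behind the discharge of the named fact `Literature.NumberTheory.LFunctions.Schoenfeld1976_eq620`
(`SchoenfeldExplicit.lean`; L. Schoenfeld, *Sharper bounds for the Chebyshev functions θ(x) and ψ(x).
II*, Math. Comp. 30 (1976), 337–360, (6.20), p. 340: "the Appel–Rosser table (1961) shows that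
`0 < {li(x) − π(x)}(log x)/√x < 2.523` if `3169 ≤ x ≤ 5·10⁷`"). The printed justification is a table
look-up (K. I. Appel, J. B. Rosser, *Table for estimating functions of primes*, IDA-CRD Technical
Report 4, 1961); here the inequality is re-done *inside Lean*, for every real `x` of the range, by the
method of the tree's `SchoenfeldSieve.lean` (which certifies (6.18) on `[2659, 10⁸)`), whose
arithmetic is reused wholesale:

* **cells.** The range is cut into cells of integers `[a, b)`; for real `x ∈ [a, b)`:
  `π(x) = π(⌊x⌋) ∈ [π(a), π(b−1)]`, `li(a) ≤ li(x) ≤ li(b)` (`li` increasing on `(1, ∞)`,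
  `strictMonoOn_logIntegral_holds`) and `log x/√x ≤ log a/√a` (`log t/√t` decreasing on `[e², ∞)`,
  Mathlib `Real.log_div_sqrt_antitoneOn`). Hence the two integer checks
  (L) `π(b−1)·2⁸⁰ < liLo a` and (U) `(liHi b − π(a)·2⁸⁰)·Lhi(a)·2³²·1000 < 2523·sqrtLo(a)·2⁸⁰·2⁸⁰`
  (`liLo a ≤ 2⁸⁰ li a`, `2⁸⁰ li b ≤ liHi b`, `2⁸⁰ log a ≤ Lhi(a)` from `KernelLog.logIv`,
  `sqrtLo a = ⌊√(a·2⁶⁴)⌋ ≤ 2³²√a`) give `0 < li x − π x` and `{li x − π x}·log x/√x < 2.523` on the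
  cell (`cell620_sound`);
* **adaptive cells with retries.** The cell length is guessed from the two slacks at `a`
  (`stepGuess620`, a heuristic with no bearing on soundness) and halved until both checks pass
  (`tryCell620`); about `18 000` cells cover `[3169, 5·10⁷]`, none needing a retry. The bound is
  genuinely tight: as `x → 3299⁻` one has `{li(x) − π(x)} log x/√x → 2.5221…`, and the checker
  isolates the unit cell `[3298, 3299)` there by itself;
* **primes and `li`.** `π` by trial division over the kernel-verified prime table
  (`SchoenfeldSieve.isPrimeF`, `countFrom_primeCounting`, valid below `10⁸`), `li` by Ramanujan's
  series in fixed point (`SchoenfeldSieve.liHi_sound`, `liLo_sound`).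

Main statements: `runCells620_sound`, the block interface `SegOK620` / `segOK620_start` /
`segOK620_step` consumed by `SchoenfeldEq620Sieve/Chunk*.lean` (one `native_decide` each, declared
`computational`) and by the assembly `SchoenfeldExplicitProofs.lean`
(`Schoenfeld1976_eq620_holds`). Everything in this file is proved from the standard axioms; nothing
uses the Riemann hypothesis.

## References

* L. Schoenfeld, Math. Comp. 30 (1976), 337–360, proof of Cor. 1, (6.20) (p. 340). [Schoenfeld1976]
* K. I. Appel, J. B. Rosser, *Table for estimating functions of primes*, IDA-CRD Technical Report
  4, Princeton 1961 (the table behind (6.20); quoted from Schoenfeld).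
-/

open Literature.Analysis.SpecialFunctions.KernelLog

namespace Literature.NumberTheory.LFunctions

namespace SchoenfeldSieve

open SchoenfeldNumerics PrimeTable

/-! ## The executable checker -/

/-- The constant of (6.20) scaled by `1000`: `2523 = 1000 · 2.523`. [cite: Schoenfeld1976, (6.20)] -/
def C620 : ℤ := 2523

/-- `sqrtLo a = ⌊√(a·2⁶⁴)⌋`, so that `sqrtLo a ≤ 2³² √a` (`sqrtLo_le`). [folklore] -/
def sqrtLo (a : ℕ) : ℕ := Nat.sqrt (a * 2 ^ 64)

/-- **One cell with retries.** `tryCell620 a stop pia llA Lhi sq fuel h`: with `pia = π(a)`,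
`llA = liLo a`, `Lhi ≥ 2⁸⁰ log a`, `sq = sqrtLo a`, try the cell `[a, b)`, `b = min stop (a + max 1 h)`:
compute `pib = π(b − 1)` by trial division and `lhB = liHi b`, and test
(L) `pib·2⁸⁰ < llA` and (U) `(lhB − pia·2⁸⁰)·Lhi·2³²·1000 < 2523·sq·2⁸⁰·2⁸⁰`; on failure retry with
`h/2` (`fuel` times). Returns `(b, π(b−1), liHi b)`. [folklore] -/
def tryCell620 (a stop pia : ℕ) (llA Lhi : ℤ) (sq : ℕ) : ℕ → ℕ → Option (ℕ × ℕ × ℤ)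
  | 0, _ => none
  | fuel + 1, h =>
      let b := min stop (a + max 1 h)
      let pib := countFrom (a + 1) (b - (a + 1)) pia
      match liHi b with
      | some lhB =>
          if (pib : ℤ) * SC < llA ∧
              (lhB - (pia : ℤ) * SC) * Lhi * 2 ^ 32 * 1000 < C620 * (sq : ℤ) * SC * SC then
            some (b, pib, lhB)
          else tryCell620 a stop pia llA Lhi sq fuel (h / 2)
      | none => none

/-- The initial guess for the cell length at `a` (pure heuristic, irrelevant to soundness): `3/4` of
the smaller of `(li a − π a)·log a` (slack of (L), in primes, times the local prime spacing) and
`(2.523 √a/log a − (li a − π a))·log a` (slack of (U)); `lhA = liHi a`, `(Llo, Lhi) = logIv a`.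
[folklore] -/
def stepGuess620 (pia : ℕ) (llA lhA Llo Lhi : ℤ) (sq : ℕ) : ℕ :=
  let slackL := llA - (pia : ℤ) * SC
  let hL := slackL * Llo * 3 / 4 / (SC * SC)
  let capU := C620 * (sq : ℤ) * SC * SC / (Lhi * 2 ^ 32 * 1000)
  let hU := (capU - (lhA - (pia : ℤ) * SC)) * Llo * 3 / 4 / (SC * SC)
  (min hL hU).toNat

/-- **The cell loop.** `runCells620 fuel a stop cntPrev lhA`: starting a cell at `a` with
`cntPrev = π(a − 1)` (and `lhA = liHi a`, used only by the step heuristic), check cells up to `stop`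
and return `π(stop − 1)`; `none` on any failure. [folklore] -/
def runCells620 : ℕ → ℕ → ℕ → ℕ → ℤ → Option ℕ
  | 0, a, stop, cnt, _ => if a = stop then some cnt else none
  | fuel + 1, a, stop, cntPrev, lhA =>
      if stop ≤ a then (if a = stop then some cntPrev else none) else
      let pia := if isPrimeF a then cntPrev + 1 else cntPrev
      match logIv a, liLo a with
      | some (Llo, Lhi), some llA =>
          let sq := sqrtLo a
          match tryCell620 a stop pia llA Lhi sq 64 (stepGuess620 pia llA lhA Llo Lhi sq) with
          | some (b, pib, lhB) => runCells620 fuel b stop pib lhB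
          | none => none
      | _, _ => none

/-- The block check: `checkSeg620 a stop cntIn cntOut = true` iff the cell loop from `a` (with
`π(a − 1) = cntIn` claimed) to `stop` passes and returns `cntOut`. [folklore] -/
def checkSeg620 (a stop cntIn cntOut : ℕ) : Bool :=
  match liHi a with
  | some lhA => (runCells620 (stop - a + 1) a stop cntIn lhA) == some cntOut
  | none => false


/-! ## Soundness -/

section Soundness

/-- `sqrtLo a ≤ 2³² √a`. [folklore] -/
theorem sqrtLo_le (a : ℕ) : (sqrtLo a : ℝ) ≤ Real.sqrt a * 2 ^ 32 := by
  unfold sqrtLo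
  have h : ((Nat.sqrt (a * 2 ^ 64) : ℕ) : ℝ) ^ 2 ≤ (a : ℝ) * 2 ^ 64 := by
    exact_mod_cast Nat.sqrt_le' (a * 2 ^ 64)
  have h2 : Real.sqrt a * 2 ^ 32 = Real.sqrt ((a : ℝ) * 2 ^ 64) := by
    rw [Real.sqrt_mul (by positivity), show ((2 : ℝ) ^ 64) = (2 ^ 32) ^ 2 by norm_num,
      Real.sqrt_sq (by positivity)]
  rw [h2]
  exact Real.le_sqrt_of_sq_le h

/-- **Soundness of one cell check**: for `3169 ≤ a < b` with `logIv a = some (Llo, Lhi)`,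
`liLo a = some llA`, `liHi b = some lhB` and the two integer checks (L), (U) at the true counts
`π(b − 1)`, `π(a)`, every real `x ∈ [a, b)` satisfies `0 < {li x − π x}·log x/√x < 2.523`.
[cite: Schoenfeld1976, (6.20)] -/
theorem cell620_sound {a b : ℕ} {Llo Lhi llA lhB : ℤ} (ha : 3169 ≤ a) (hab : a < b)
    (hlog : logIv a = some (Llo, Lhi)) (hll : liLo a = some llA) (hlh : liHi b = some lhB)
    (hL : (Nat.primeCounting (b - 1) : ℤ) * SC < llA)
    (hU : (lhB - (Nat.primeCounting a : ℤ) * SC) * Lhi * 2 ^ 32 * 1000 <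
      C620 * (sqrtLo a : ℤ) * SC * SC) :
    ∀ x : ℝ, (a : ℝ) ≤ x → x < b →
      0 < (logIntegral x - Nat.primeCounting ⌊x⌋₊) * Real.log x / √x ∧
        (logIntegral x - Nat.primeCounting ⌊x⌋₊) * Real.log x / √x < 2.523 := by
  intro x hax hxb
  have ha1 : (1 : ℝ) < a := by exact_mod_cast (lt_of_lt_of_le (by norm_num) ha)
  have ha8 : (8 : ℝ) ≤ a := by exact_mod_cast (le_trans (by norm_num) ha)
  have hx1 : 1 < x := by linarith
  have hx0 : 0 ≤ x := by linarith
  have hb1 : 1 < b := by omega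
  -- the floor
  have hfl1 : a ≤ ⌊x⌋₊ := Nat.le_floor hax
  have hfl2 : ⌊x⌋₊ ≤ b - 1 := by have := (Nat.floor_lt hx0).2 hxb; omega
  have hπ1 : (Nat.primeCounting a : ℝ) ≤ Nat.primeCounting ⌊x⌋₊ := by
    exact_mod_cast Nat.monotone_primeCounting hfl1
  have hπ2 : (Nat.primeCounting ⌊x⌋₊ : ℝ) ≤ Nat.primeCounting (b - 1) := by
    exact_mod_cast Nat.monotone_primeCounting hfl2
  -- li
  have hmono : StrictMonoOn logIntegral (Set.Ioi 1) := strictMonoOn_logIntegral_holds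
  have hli1 : logIntegral a ≤ logIntegral x := hmono.monotoneOn ha1 hx1 hax
  have hli2 : logIntegral x ≤ logIntegral b :=
    hmono.monotoneOn hx1 (show (1 : ℝ) < (b : ℝ) by exact_mod_cast hb1) hxb.le
  have hlo := liLo_sound hll (by omega : 3 ≤ a)
  have hhi := liHi_sound hlh hb1
  -- the integer checks read in `ℝ`
  have hLr : (Nat.primeCounting (b - 1) : ℝ) * 2 ^ 80 < llA := by
    have : (((Nat.primeCounting (b - 1) : ℤ) * SC : ℤ) : ℝ) < (llA : ℝ) := by exact_mod_cast hL
    rw [← SC_eq]; push_cast at this ⊢; exact this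
  have hUr : ((lhB : ℝ) - (Nat.primeCounting a : ℝ) * 2 ^ 80) * Lhi * 2 ^ 32 * 1000 <
      2523 * (sqrtLo a : ℝ) * 2 ^ 80 * 2 ^ 80 := by
    have : (((lhB - (Nat.primeCounting a : ℤ) * SC) * Lhi * 2 ^ 32 * 1000 : ℤ) : ℝ) <
        ((C620 * (sqrtLo a : ℤ) * SC * SC : ℤ) : ℝ) := by exact_mod_cast hU
    unfold C620 at this
    rw [← SC_eq]; push_cast at this ⊢; linarith
  -- positivity of `li x − π x`
  set D : ℝ := logIntegral x - Nat.primeCounting ⌊x⌋₊ with hD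
  have hD0 : 0 < D := by rw [hD]; linarith
  have hlogx : 0 < Real.log x := Real.log_pos hx1
  have hsx : 0 < Real.sqrt x := Real.sqrt_pos.2 (by linarith)
  refine ⟨div_pos (mul_pos hD0 hlogx) hsx, ?_⟩
  -- the upper bound
  have hsa : 0 < Real.sqrt a := Real.sqrt_pos.2 (by linarith)
  have hloga : 0 < Real.log a := Real.log_pos ha1
  have hg : Real.log x / Real.sqrt x ≤ Real.log a / Real.sqrt a := by
    -- `e² ≤ 8 ≤ a` (as in the tree's `BrunTwinPrimes.exp_two_le_eight`, inlined to keep imports small)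
    have he8 : Real.exp 2 ≤ 8 := by
      have h : Real.exp 2 = Real.exp 1 ^ 2 := by rw [← Real.exp_nat_mul]; norm_num
      have h2 : Real.exp 1 ^ 2 < 2.7182818286 ^ 2 :=
        pow_lt_pow_left₀ Real.exp_one_lt_d9 (Real.exp_pos 1).le (by norm_num)
      rw [h]; norm_num at h2 ⊢; linarith
    have he : Real.exp 2 ≤ (a : ℝ) := le_trans he8 ha8
    exact Real.log_div_sqrt_antitoneOn (Set.mem_Ici.2 he) (Set.mem_Ici.2 (he.trans hax)) hax
  have hLhi : Real.log a * 2 ^ 80 ≤ Lhi := by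
    have := (logIv_sound hlog).2; rwa [le_div_iff₀ (by positivity)] at this
  have hsq : (sqrtLo a : ℝ) ≤ Real.sqrt a * 2 ^ 32 := sqrtLo_le a
  have hDhi : D * 2 ^ 80 ≤ (lhB : ℝ) - (Nat.primeCounting a : ℝ) * 2 ^ 80 := by rw [hD]; linarith
  have hg' : Real.log x * Real.sqrt a ≤ Real.log a * Real.sqrt x := by
    rw [div_le_div_iff₀ hsx hsa] at hg; linarith
  -- `D · log a < 2.523 · √a`
  have hkey : D * Real.log a < 2.523 * Real.sqrt a := by
    set X : ℝ := (lhB : ℝ) - (Nat.primeCounting a : ℝ) * 2 ^ 80 with hX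
    have hX0 : 0 < X := lt_of_lt_of_le (by positivity) hDhi
    have h1 : D * Real.log a * 2 ^ 80 * 2 ^ 80 ≤ X * Lhi :=
      calc D * Real.log a * 2 ^ 80 * 2 ^ 80 = (D * 2 ^ 80) * (Real.log a * 2 ^ 80) := by ring
        _ ≤ X * (Real.log a * 2 ^ 80) :=
            mul_le_mul_of_nonneg_right hDhi (by positivity)
        _ ≤ X * Lhi := mul_le_mul_of_nonneg_left hLhi hX0.le
    have h2 : X * Lhi * 2 ^ 32 * 1000 < 2523 * (Real.sqrt a * 2 ^ 32) * 2 ^ 80 * 2 ^ 80 :=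
      calc X * Lhi * 2 ^ 32 * 1000 < 2523 * (sqrtLo a : ℝ) * 2 ^ 80 * 2 ^ 80 := hUr
        _ ≤ 2523 * (Real.sqrt a * 2 ^ 32) * 2 ^ 80 * 2 ^ 80 := by gcongr
    have h1' := mul_le_mul_of_nonneg_right h1 (show (0 : ℝ) ≤ 2 ^ 32 * 1000 by positivity)
    have h3 : D * Real.log a * (2 ^ 80 * 2 ^ 80 * 2 ^ 32 * 1000) <
        2.523 * Real.sqrt a * (2 ^ 80 * 2 ^ 80 * 2 ^ 32 * 1000) := by
      nlinarith [h1', h2]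
    exact lt_of_mul_lt_mul_right h3 (by positivity)
  have h4 : D * Real.log x * Real.sqrt a ≤ D * Real.log a * Real.sqrt x := by
    have := mul_le_mul_of_nonneg_left hg' hD0.le
    linarith
  have h5 : D * Real.log a * Real.sqrt x < 2.523 * Real.sqrt a * Real.sqrt x :=
    mul_lt_mul_of_pos_right hkey hsx
  rw [div_lt_iff₀ hsx]
  have h6 : D * Real.log x * Real.sqrt a < 2.523 * Real.sqrt x * Real.sqrt a := by linarith
  exact lt_of_mul_lt_mul_right h6 hsa.le

/-- **What a successful `tryCell620` returns**: a cell end `b` with `a < b ≤ stop`, the trial-division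
count `pib = countFrom (a+1) (b−(a+1)) pia`, `liHi b`, and the two passed checks. [folklore] -/
theorem tryCell620_spec (a stop pia : ℕ) (llA Lhi : ℤ) (sq : ℕ) (has : a < stop) :
    ∀ (fuel h : ℕ) {b pib : ℕ} {lhB : ℤ},
      tryCell620 a stop pia llA Lhi sq fuel h = some (b, pib, lhB) →
      a < b ∧ b ≤ stop ∧ pib = countFrom (a + 1) (b - (a + 1)) pia ∧ liHi b = some lhB ∧
        (pib : ℤ) * SC < llA ∧
          (lhB - (pia : ℤ) * SC) * Lhi * 2 ^ 32 * 1000 < C620 * (sq : ℤ) * SC * SC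
  | 0, h, b, pib, lhB, hr => by simp [tryCell620] at hr
  | fuel + 1, h, b, pib, lhB, hr => by
      rw [tryCell620] at hr
      generalize hb : min stop (a + max 1 h) = b₀ at hr
      have hab : a < b₀ := by rw [← hb]; exact lt_min has (by omega)
      have hbs : b₀ ≤ stop := by rw [← hb]; exact min_le_left _ _
      split at hr
      · rename_i lhB₀ hlh
        split_ifs at hr with hchk
        · simp only [Option.some.injEq, Prod.mk.injEq] at hr
          obtain ⟨rfl, rfl, rfl⟩ := hr
          exact ⟨hab, hbs, rfl, hlh, hchk.1, hchk.2⟩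
        · exact tryCell620_spec a stop pia llA Lhi sq has fuel (h / 2) hr
      · simp at hr

/-- **Soundness of the cell loop**: a successful run from `a` with the correct count `π(a − 1)`
returns `π(stop − 1)` and proves (6.20) on `[a, stop)`. [cite: Schoenfeld1976, (6.20)] -/
theorem runCells620_sound : ∀ (fuel a stop cnt : ℕ) (lhA : ℤ) (c' : ℕ),
    runCells620 fuel a stop cnt lhA = some c' → 3169 ≤ a → a ≤ stop → stop ≤ 10 ^ 8 + 1 →
    cnt = Nat.primeCounting (a - 1) →
    c' = Nat.primeCounting (stop - 1) ∧
      ∀ x : ℝ, (a : ℝ) ≤ x → x < stop →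
        0 < (logIntegral x - Nat.primeCounting ⌊x⌋₊) * Real.log x / √x ∧
          (logIntegral x - Nat.primeCounting ⌊x⌋₊) * Real.log x / √x < 2.523
  | 0, a, stop, cnt, lhA, c', h, ha, has, hs, hc => by
      simp only [runCells620] at h
      split_ifs at h with he
      simp only [Option.some.injEq] at h
      subst he; subst h
      exact ⟨hc, fun x h1 h2 ↦ absurd (lt_of_le_of_lt h1 h2) (lt_irrefl _)⟩
  | fuel + 1, a, stop, cnt, lhA, c', h, ha, has, hs, hc => by
      rw [runCells620] at h
      by_cases hsa : stop ≤ a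
      · rw [if_pos hsa] at h
        have he : a = stop := le_antisymm has hsa
        rw [if_pos he] at h
        simp only [Option.some.injEq] at h
        subst he; subst h
        exact ⟨hc, fun x h1 h2 ↦ absurd (lt_of_le_of_lt h1 h2) (lt_irrefl _)⟩
      rw [if_neg hsa] at h
      rw [not_le] at hsa
      -- `π(a)`
      have hpia : (if isPrimeF a = true then cnt + 1 else cnt) = Nat.primeCounting a := by
        rw [← countFrom_one, countFrom_primeCounting (by omega) (by omega) hc]
        congr 1
      generalize hP : (if isPrimeF a = true then cnt + 1 else cnt) = pia at h hpia
      split at h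
      · rename_i Llo Lhi llA hlog hll
        dsimp only at h
        split at h
        · rename_i b pib lhB htc
          obtain ⟨hab, hbs, hpib, hlh, hL, hU⟩ :=
            tryCell620_spec a stop pia llA Lhi (sqrtLo a) hsa _ _ htc
          have hpib' : pib = Nat.primeCounting (b - 1) := by
            rw [hpib, countFrom_primeCounting (by omega) (by omega)
              (by rw [Nat.add_sub_cancel]; exact hpia)]
            congr 1; omega
          subst hpia; subst hpib'
          have ih := runCells620_sound fuel b stop _ lhB c' h (by omega) hbs hs rfl
          refine ⟨ih.1, fun x hx1 hx2 ↦ ?_⟩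
          by_cases hxb : x < b
          · exact cell620_sound ha hab hlog hll hlh hL hU x hx1 hxb
          · exact ih.2 x (not_lt.1 hxb) hx2
        · simp at h
      · simp at h

/-! ### Block interface -/

/-- **The block invariant** at a boundary `a` with count `c`: `c = π(a − 1)` and (6.20) holds for
every real `x ∈ [3169, a)`. [cite: Schoenfeld1976, (6.20)] -/
def SegOK620 (a c : ℕ) : Prop :=
  c = Nat.primeCounting (a - 1) ∧
    ∀ x : ℝ, 3169 ≤ x → x < a →
      0 < (logIntegral x - Nat.primeCounting ⌊x⌋₊) * Real.log x / √x ∧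
        (logIntegral x - Nat.primeCounting ⌊x⌋₊) * Real.log x / √x < 2.523

/-- `π(3168) = 448` (from the kernel-verified prime table). [folklore] -/
theorem primeCounting_3168 : Nat.primeCounting 3168 = 448 := by
  rw [primeCounting_eq_of_table primeTable_ok primeTable_ne_nil primeTable_prime primeTable_nodup
    (by rw [primeTable_getLast]; norm_num)]
  decide +kernel

/-- The start: `π(3168) = 448` and an empty range. [folklore] -/
theorem segOK620_start : SegOK620 3169 448 :=
  ⟨by rw [show 3169 - 1 = 3168 from rfl, primeCounting_3168],
    fun x h1 h2 ↦ absurd (lt_of_le_of_lt h1 (by exact_mod_cast h2)) (lt_irrefl _)⟩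

/-- **One block**: a passing `checkSeg620 a stop cIn cOut` carries the invariant from `a` to `stop`
(`stop ≤ 10⁸ + 1`, the range of validity of the trial division). [cite: Schoenfeld1976, (6.20)] -/
theorem segOK620_step {a stop cIn cOut : ℕ} (h : checkSeg620 a stop cIn cOut = true)
    (ha : 3169 ≤ a) (has : a ≤ stop) (hs : stop ≤ 10 ^ 8 + 1) (hseg : SegOK620 a cIn) :
    SegOK620 stop cOut := by
  unfold checkSeg620 at h
  split at h
  · rename_i lhA _
    have hrun : runCells620 (stop - a + 1) a stop cIn lhA = some cOut := by simpa using h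
    have hsound := runCells620_sound _ _ _ _ _ _ hrun ha has hs hseg.1
    refine ⟨hsound.1, fun x hx1 hx2 ↦ ?_⟩
    by_cases hxa : x < a
    · exact hseg.2 x hx1 hxa
    · exact hsound.2 x (not_lt.1 hxa) hx2
  · simp at h

end Soundness

end SchoenfeldSieve

end Literature.NumberTheory.LFunctions
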